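import Summits.NavierStokesRegularity.NavierStokesRegularity.Theorems.ScenarioCensusRowF5lgTube
import HarnessLib

/-!
# Census rows F5lg / F5r (ns-idea-4 LINE «log-gate») — part 4/5: O1 the explicit log barrier, Wei's window, assembly at ν = 1, O4 time dilation

Part of the five-file re-homing (typer seat ns-census-typer-1 g5) of ns-idea-4 g10's LINE «log-gate» v1.1 (sha16 136999c2b89a0c68);
provenance and the file map are in `ScenarioCensusRowF5lgGate`.  Lean text verbatim in namespace `…Theorems.ScenarioCensus.LogGate`.
No census value is asserted here; NS regularity is NOT proved; no summit statement is proved by this file.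
-/

noncomputable section
set_option linter.dupNamespace false

open Literature.Analysis.FluidPDE MeasureTheory Set Filter Topology
open scoped ENNReal NNReal RealInnerProductSpace

namespace Summit.NavierStokesRegularity.NavierStokesRegularity.Theorems.ScenarioCensus.LogGate

open Summit.NavierStokesRegularity.NavierStokesRegularity.Theorems
open Summit.NavierStokesRegularity.NavierStokesRegularity.Theorems.ScenarioCensus

/-! ## §3 O1 — the explicit log barrier `w_β(r) = (log(1/r))^{−β}` (PROVED) -/

/-- The iterated-log barrier `w_β(r) = (−log r)^{−β}` (`= (log(1/r))^{−β}` on `(0,1)`; value `0` at `r = 0` since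
`Real.log 0 = 0` and `0 ^ (−β) = 0`). [new] -/
def logBarrier (β r : ℝ) : ℝ :=
  (-Real.log r) ^ (-β)

/-- Its first derivative on `(0,1)`: `w_β′(r) = β (−log r)^{−β−1} / r`. -/
def logBarrierD1 (β r : ℝ) : ℝ :=
  β * (-Real.log r) ^ (-β - 1) * r⁻¹

/-- Its second derivative on `(0,1)`: `w_β″(r) = β(β+1)(−log r)^{−β−2}/r² − β(−log r)^{−β−1}/r²`. -/
def logBarrierD2 (β r : ℝ) : ℝ :=
  β * ((β + 1) * (-Real.log r) ^ (-β - 2) * r⁻¹) * r⁻¹ + β * (-Real.log r) ^ (-β - 1) * (-(r ^ 2)⁻¹)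

/-- `0 < −log r` for `0 < r < 1`. [folklore] -/
theorem neg_log_pos {r : ℝ} (h0 : 0 < r) (h1 : r < 1) : 0 < -Real.log r := by
  have := Real.log_neg h0 h1
  linarith

/-- `w_β(0) = 0` (junk value of `Real.log 0`). [folklore] -/
theorem logBarrier_zero (β : ℝ) (hβ : 0 < β) : logBarrier β 0 = 0 := by
  simp [logBarrier, Real.zero_rpow (neg_ne_zero.2 hβ.ne')]

/-- `w_β(r) > 0` on `(0,1)`. [folklore] -/
theorem logBarrier_pos {β r : ℝ} (h0 : 0 < r) (h1 : r < 1) : 0 < logBarrier β r :=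
  Real.rpow_pos_of_pos (neg_log_pos h0 h1) _

/-- Derivative of the log barrier on `(0,1)`. [folklore] -/
theorem hasDerivAt_logBarrier {β r : ℝ} (h0 : 0 < r) (h1 : r < 1) :
    HasDerivAt (logBarrier β) (logBarrierD1 β r) r := by
  have hℓ : 0 < -Real.log r := neg_log_pos h0 h1
  have hin : HasDerivAt (fun ρ => -Real.log ρ) (-r⁻¹) r := (Real.hasDerivAt_log h0.ne').neg
  have hout : HasDerivAt (fun y : ℝ => y ^ (-β)) ((-β) * (-Real.log r) ^ (-β - 1)) (-Real.log r) :=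
    Real.hasDerivAt_rpow_const (Or.inl hℓ.ne')
  have h := hout.comp r hin
  have heq : (-β) * (-Real.log r) ^ (-β - 1) * -r⁻¹ = logBarrierD1 β r := by
    unfold logBarrierD1; ring
  rw [heq] at h
  exact h

/-- Derivative of `w_β′` on `(0,1)`. [folklore] -/
theorem hasDerivAt_logBarrierD1 {β r : ℝ} (h0 : 0 < r) (h1 : r < 1) :
    HasDerivAt (logBarrierD1 β) (logBarrierD2 β r) r := by
  have hℓ : 0 < -Real.log r := neg_log_pos h0 h1
  have hin : HasDerivAt (fun ρ => -Real.log ρ) (-r⁻¹) r := (Real.hasDerivAt_log h0.ne').neg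
  have hout : HasDerivAt (fun y : ℝ => y ^ (-β - 1)) ((-β - 1) * (-Real.log r) ^ (-β - 1 - 1)) (-Real.log r) :=
    Real.hasDerivAt_rpow_const (Or.inl hℓ.ne')
  have hpow : HasDerivAt (fun ρ => (-Real.log ρ) ^ (-β - 1)) ((β + 1) * (-Real.log r) ^ (-β - 2) * r⁻¹) r := by
    have h := hout.comp r hin
    have heq : (-β - 1) * (-Real.log r) ^ (-β - 1 - 1) * -r⁻¹ = (β + 1) * (-Real.log r) ^ (-β - 2) * r⁻¹ := by
      rw [show (-β - 1 - 1 : ℝ) = -β - 2 by ring]; ring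
    rw [heq] at h
    exact h
  have hinv : HasDerivAt (fun ρ : ℝ => ρ⁻¹) (-(r ^ 2)⁻¹) r := hasDerivAt_inv h0.ne'
  have h := ((hpow.const_mul β).mul hinv)
  have heq : logBarrierD1 β = ((fun y => β * (-Real.log y) ^ (-β - 1)) * fun ρ : ℝ => ρ⁻¹) := by
    funext ρ; rfl
  rw [heq]
  exact h

/-- `deriv` and `iteratedDeriv 2` of the barrier on `(0,1)` are the explicit `logBarrierD1`, `logBarrierD2`. -/
theorem deriv_logBarrier {β r : ℝ} (h0 : 0 < r) (h1 : r < 1) :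
    deriv (logBarrier β) r = logBarrierD1 β r :=
  (hasDerivAt_logBarrier h0 h1).deriv

/-- Second derivative of the log barrier on `(0,1)`. [folklore] -/
theorem iteratedDeriv_two_logBarrier {β r : ℝ} (h0 : 0 < r) (h1 : r < 1) :
    iteratedDeriv 2 (logBarrier β) r = logBarrierD2 β r := by
  rw [iteratedDeriv_succ, iteratedDeriv_one]
  have hev : deriv (logBarrier β) =ᶠ[𝓝 r] logBarrierD1 β := by
    have hmem : Ioo (0 : ℝ) 1 ∈ 𝓝 r := Ioo_mem_nhds h0 h1
    filter_upwards [hmem] with ρ hρ using deriv_logBarrier hρ.1 hρ.2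
  rw [hev.deriv_eq]
  exact (hasDerivAt_logBarrierD1 h0 h1).deriv

/-- **THE DICTIONARY IDENTITY (PROVED, both readings).** For inflow number `m = 2 − c/ℓ`, `ℓ = log(1/r)`, the radial swirl
operator applied to `ℓ^{−β}` is `β(β + 1 − c)·ℓ^{−β−2}·r^{−2}`:
`w″ − w′/r + ((2 − c/ℓ)/r)·w′ = β(β+1−c) ℓ^{−β−2} r^{−2}`. Supersolution iff `c ≥ β + 1`; for `c < β + 1` it is a strict
SUBSOLUTION (the gate is open: no log-power barrier, the passive threshold being `c > 1 ⟺ ∃ β > 0`). -/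
theorem logBarrier_operator {β c r : ℝ} (h0 : 0 < r) (h1 : r < 1) :
    logBarrierD2 β r - r⁻¹ * logBarrierD1 β r + logInflowEnvelope c 1 r * logBarrierD1 β r
      = β * (β + 1 - c) * (-Real.log r) ^ (-β - 2) * (r ^ 2)⁻¹ := by
  have hℓ : 0 < -Real.log r := neg_log_pos h0 h1
  have hℓne : Real.log r ≠ 0 := (Real.log_neg h0 h1).ne
  have hr : r ≠ 0 := h0.ne'
  have hsplit : (-Real.log r) ^ (-β - 1) = (-Real.log r) ^ (-β - 2) * (-Real.log r) := by
    rw [show (-β - 1 : ℝ) = (-β - 2) + 1 by ring, Real.rpow_add hℓ, Real.rpow_one]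
  unfold logBarrierD2 logBarrierD1 logInflowEnvelope
  rw [hsplit]
  field_simp
  ring

/-- Supersolution sign: for `c ≥ β + 1`, `β ≥ 0`, the barrier clause holds. -/
theorem logBarrier_supersolution {β c r : ℝ} (hβ : 0 ≤ β) (hc : β + 1 ≤ c) (h0 : 0 < r) (h1 : r < 1) :
    logBarrierD2 β r - r⁻¹ * logBarrierD1 β r + logInflowEnvelope c 1 r * logBarrierD1 β r ≤ 0 := by
  rw [logBarrier_operator h0 h1]
  have hP : 0 < (-Real.log r) ^ (-β - 2) := Real.rpow_pos_of_pos (neg_log_pos h0 h1) _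
  have hr2 : 0 < (r ^ 2)⁻¹ := inv_pos.2 (pow_pos h0 2)
  have : β * (β + 1 - c) ≤ 0 := mul_nonpos_of_nonneg_of_nonpos hβ (by linarith)
  have := mul_nonpos_of_nonpos_of_nonneg (mul_nonpos_of_nonpos_of_nonneg this hP.le) hr2.le
  simpa [mul_assoc] using this

/-- Calibration (PROVED): for `c < β + 1`, `β > 0`, the same expression is STRICTLY POSITIVE — the log gate is open. -/
theorem logBarrier_fails {β c r : ℝ} (hβ : 0 < β) (hc : c < β + 1) (h0 : 0 < r) (h1 : r < 1) :
    0 < logBarrierD2 β r - r⁻¹ * logBarrierD1 β r + logInflowEnvelope c 1 r * logBarrierD1 β r := by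
  rw [logBarrier_operator h0 h1]
  have hP : 0 < (-Real.log r) ^ (-β - 2) := Real.rpow_pos_of_pos (neg_log_pos h0 h1) _
  have hr2 : 0 < (r ^ 2)⁻¹ := inv_pos.2 (pow_pos h0 2)
  have : 0 < β * (β + 1 - c) := mul_pos hβ (by linarith)
  positivity

/-- `w_β′ ≥ 0` on `(0,1)`. -/
theorem logBarrierD1_nonneg {β r : ℝ} (hβ : 0 ≤ β) (h0 : 0 < r) (h1 : r < 1) : 0 ≤ logBarrierD1 β r := by
  unfold logBarrierD1
  have hP : 0 < (-Real.log r) ^ (-β - 1) := Real.rpow_pos_of_pos (neg_log_pos h0 h1) _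
  have := inv_pos.2 h0
  positivity

/-- Growth clause (PROVED): `r² ≤ β^β · w_β(r)` on `(0,1)` — from `log x ≤ x^ε/ε` (`Real.log_le_rpow_div`) at `x = 1/r`,
`ε = 1/β`: `ℓ ≤ β r^{−1/β}`, so `ℓ^β ≤ β^β/r` and `r² ℓ^β ≤ β^β r ≤ β^β`. -/
theorem sq_le_mul_logBarrier {β r : ℝ} (hβ : 0 < β) (h0 : 0 < r) (h1 : r < 1) :
    r ^ 2 ≤ β ^ β * logBarrier β r := by
  have hℓ : 0 < -Real.log r := neg_log_pos h0 h1
  -- ℓ = log (1/r) ≤ (1/r)^(1/β) / (1/β) = β * (r⁻¹)^(1/β)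
  have hlog : -Real.log r ≤ β * r⁻¹ ^ (1 / β) := by
    have h := Real.log_le_rpow_div (inv_pos.2 h0).le (one_div_pos.2 hβ)
    rw [Real.log_inv] at h
    calc -Real.log r ≤ r⁻¹ ^ (1 / β) / (1 / β) := h
      _ = β * r⁻¹ ^ (1 / β) := by rw [div_div_eq_mul_div, div_one, mul_comm]
  -- raise to the power β: ℓ^β ≤ β^β * r⁻¹
  have hpow : (-Real.log r) ^ β ≤ β ^ β * r⁻¹ := by
    have h := Real.rpow_le_rpow hℓ.le hlog hβ.le
    rw [Real.mul_rpow hβ.le (Real.rpow_nonneg (inv_pos.2 h0).le _), ← Real.rpow_mul (inv_pos.2 h0).le,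
      one_div_mul_cancel hβ.ne', Real.rpow_one] at h
    exact h
  -- w = ℓ^(-β) = (ℓ^β)⁻¹
  have hw : logBarrier β r = ((-Real.log r) ^ β)⁻¹ := by
    rw [logBarrier, Real.rpow_neg hℓ.le]
  rw [hw]
  have hℓβ : 0 < (-Real.log r) ^ β := Real.rpow_pos_of_pos hℓ _
  rw [← div_eq_mul_inv, le_div_iff₀ hℓβ]
  calc r ^ 2 * (-Real.log r) ^ β ≤ r ^ 2 * (β ^ β * r⁻¹) := mul_le_mul_of_nonneg_left hpow (sq_nonneg r)
    _ = β ^ β * r := by field_simp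
    _ ≤ β ^ β * 1 := mul_le_mul_of_nonneg_left h1.le (Real.rpow_nonneg hβ.le _)
    _ = β ^ β := mul_one _

/-- Continuity of the barrier on `[0, δ₀]` (`δ₀ < 1`), including at the axis where `w_β → 0 = w_β(0)`. -/
theorem continuousOn_logBarrier {β δ₀ : ℝ} (hβ : 0 < β) (hδ : δ₀ < 1) :
    ContinuousOn (logBarrier β) (Icc 0 δ₀) := by
  intro r hr
  rcases hr.1.eq_or_lt with h0 | h0
  · -- at the axis: (−log r)^(−β) → 0 as r → 0⁺
    subst h0
    have hlim : Tendsto (logBarrier β) (𝓝[>] 0) (𝓝 0) := by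
      have h1 : Tendsto (fun r : ℝ => -Real.log r) (𝓝[>] 0) atTop :=
        tendsto_neg_atBot_atTop.comp Real.tendsto_log_nhdsGT_zero
      exact (tendsto_rpow_neg_atTop hβ).comp h1
    have hIoi : ContinuousWithinAt (logBarrier β) (Ioi 0) 0 := by
      rw [ContinuousWithinAt, logBarrier_zero β hβ]
      exact hlim
    exact (continuousWithinAt_Ioi_iff_Ici.1 hIoi).mono Icc_subset_Ici_self
  · have h1 : r < 1 := lt_of_le_of_lt hr.2 hδ
    exact (hasDerivAt_logBarrier (β := β) h0 h1).continuousAt.continuousWithinAt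

/-- `C²` (indeed smooth) on `(0, δ₀)`, `δ₀ ≤ 1`: composition of `−log` (smooth off `0`) with `y ↦ y^{−β}` (smooth off `0`). -/
theorem contDiffOn_logBarrier {β δ₀ : ℝ} (hδ : δ₀ ≤ 1) : ContDiffOn ℝ 2 (logBarrier β) (Ioo 0 δ₀) := by
  intro r hr
  have h0 : 0 < r := hr.1
  have h1 : r < 1 := lt_of_lt_of_le hr.2 hδ
  have hℓ : 0 < -Real.log r := neg_log_pos h0 h1
  have hin : ContDiffAt ℝ 2 (fun ρ : ℝ => -Real.log ρ) r := (Real.contDiffAt_log.2 h0.ne').neg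
  have hout : ContDiffAt ℝ 2 (fun y : ℝ => y ^ (-β)) (-Real.log r) :=
    Real.contDiffAt_rpow_const_of_ne hℓ.ne'
  exact (hout.comp r hin).contDiffWithinAt

/-- **O1 (PROVED): the log barrier is a tube barrier for the log gate** — for `0 < β`, `β + 1 ≤ c`, `0 < δ₀ < 1`. -/
theorem logBarrier_isTubeBarrier {β c δ₀ : ℝ} (hβ : 0 < β) (hc : β + 1 ≤ c) (hδ : 0 < δ₀) (hδ1 : δ₀ < 1) :
    IsTubeBarrier δ₀ (logInflowEnvelope c 1) (logBarrier β) := by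
  refine ⟨contDiffOn_logBarrier hδ1.le, continuousOn_logBarrier hβ hδ1, logBarrier_zero β hβ,
    logBarrier_pos hδ hδ1, ⟨β ^ β, fun r hr => ?_⟩, fun r hr => ?_, fun r hr => ?_⟩
  · rcases hr.1.eq_or_lt with h0 | h0
    · subst h0
      rw [logBarrier_zero β hβ]; simp
    · exact sq_le_mul_logBarrier hβ h0 (lt_of_le_of_lt hr.2 hδ1)
  · rw [deriv_logBarrier hr.1 (hr.2.trans hδ1)]
    exact logBarrierD1_nonneg hβ.le hr.1 (hr.2.trans hδ1)
  · rw [deriv_logBarrier hr.1 (hr.2.trans hδ1), iteratedDeriv_two_logBarrier hr.1 (hr.2.trans hδ1)]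
    exact logBarrier_supersolution hβ.le hc hr.1 (hr.2.trans hδ1)

/-! ## §4 O3 — the Wei window and the closure at `ν = 1` (PROVED modulo O2) -/

/-- **Wei window (PROVED).** If `β > 3/2` and `A ≥ 0`, then `A·(log(1/r))^{−β} ≤ |log r|^{−3/2}` on a thin enough tube
`0 < r ≤ δ₁` (`δ₁ < 1/2`, `δ₁ ≤ δ₀`): take `ℓ₁ = (max A 1)^{1/(β−3/2)} ≥ 1` and `δ₁ = min δ₀ (min (1/4) (exp(−ℓ₁)))`. -/
theorem wei_window {β A δ₀ : ℝ} (hβ : 3 / 2 < β) (_hA : 0 ≤ A) (hδ : 0 < δ₀) :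
    ∃ δ₁ : ℝ, 0 < δ₁ ∧ δ₁ < 1 / 2 ∧ δ₁ ≤ δ₀ ∧
      ∀ r : ℝ, 0 < r → r ≤ δ₁ → A * logBarrier β r ≤ |Real.log r| ^ (-(3 / 2 : ℝ)) := by
  set γ : ℝ := β - 3 / 2 with hγ_def
  have hγ : 0 < γ := by rw [hγ_def]; linarith
  set ℓ₁ : ℝ := (max A 1) ^ (1 / γ) with hℓ₁_def
  have hmax : 1 ≤ max A 1 := le_max_right _ _
  have hℓ₁ : 1 ≤ ℓ₁ := Real.one_le_rpow hmax (one_div_pos.2 hγ).le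
  refine ⟨min δ₀ (min (1 / 4) (Real.exp (-ℓ₁))), ?_, ?_, min_le_left _ _, fun r hr0 hr => ?_⟩
  · exact lt_min hδ (lt_min (by norm_num) (Real.exp_pos _))
  · calc min δ₀ (min (1 / 4) (Real.exp (-ℓ₁))) ≤ min (1 / 4) (Real.exp (-ℓ₁)) := min_le_right _ _
      _ ≤ 1 / 4 := min_le_left _ _
      _ < 1 / 2 := by norm_num
  · have hr14 : r ≤ 1 / 4 := hr.trans ((min_le_right _ _).trans (min_le_left _ _))
    have hr1 : r < 1 := by linarith
    have hℓ : 0 < -Real.log r := neg_log_pos hr0 hr1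
    -- ℓ := −log r ≥ ℓ₁
    have hℓge : ℓ₁ ≤ -Real.log r := by
      have hre : r ≤ Real.exp (-ℓ₁) := hr.trans ((min_le_right _ _).trans (min_le_right _ _))
      have := Real.log_le_log hr0 hre
      rw [Real.log_exp] at this
      linarith
    have habs : |Real.log r| = -Real.log r := by
      rw [abs_of_neg (Real.log_neg hr0 hr1)]
    rw [habs, logBarrier]
    -- goal: A * ℓ^(-β) ≤ ℓ^(-3/2); i.e. A ≤ ℓ^(β - 3/2) = ℓ^γ
    have hℓγ : A ≤ (-Real.log r) ^ γ := by
      calc A ≤ max A 1 := le_max_left _ _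
        _ = ℓ₁ ^ γ := by
            rw [hℓ₁_def, ← Real.rpow_mul (le_trans zero_le_one hmax), one_div_mul_cancel hγ.ne', Real.rpow_one]
        _ ≤ (-Real.log r) ^ γ := Real.rpow_le_rpow (by linarith) hℓge hγ.le
    have hsplit : (-Real.log r) ^ (-(3 / 2 : ℝ)) = (-Real.log r) ^ γ * (-Real.log r) ^ (-β) := by
      rw [← Real.rpow_add hℓ]; congr 1; rw [hγ_def]; ring
    rw [hsplit]
    exact mul_le_mul_of_nonneg_right hℓγ (Real.rpow_nonneg hℓ.le _)

/-- **R at `ν = 1` modulo O2 (PROVED).** The comparison with the log barrier `β := c − 1 > 3/2` and Wei's criterion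
(`Wei2016_logModulus_regularity_holds`, tree) give the unit-viscosity log-gate criterion. -/
theorem logGateCriterionNuOne_of_comparison (hcmp : TubeComparison) : LogGateCriterionNuOne := by
  intro c δ₀ T hc hδ hδ' hT u p hcl hLH hdec hbd hax hgate
  set β : ℝ := c - 1 with hβ_def
  have hβ : 3 / 2 < β := by rw [hβ_def]; linarith
  have hβ0 : 0 < β := by linarith
  have hδ1 : δ₀ < 1 := by linarith
  have hB : IsTubeBarrier δ₀ (logInflowEnvelope c 1) (logBarrier β) :=
    logBarrier_isTubeBarrier hβ0 (by rw [hβ_def]; linarith) hδ hδ1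
  obtain ⟨L, hL, hini, hglob⟩ := swirl_data_bounds hT hcl hdec hbd hax
  obtain ⟨A, hA, hdom⟩ := hcmp T δ₀ L (logInflowEnvelope c 1) (logBarrier β) hT hδ hL hB u p hcl hbd hax
    (fun t ht x h0 hr => hgate t ht x h0 hr) hini hglob
  obtain ⟨δ₁, hδ₁, hδ₁', hδ₁₀, hwin⟩ := wei_window hβ hA hδ
  refine Wei2016_logModulus_regularity_holds δ₁ hδ₁ hδ₁' T u p hT hcl hLH hdec hax hdec.eLpNorm_swirl_lt_top ?_
  intro t ht x h0 hr
  exact (hdom t ht x (hr.trans hδ₁₀)).trans (hwin (cylRadius x) h0 hr)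

/-! ## §5 O4 — viscosity scaling (PROVED): `LogGateCriterionNuOne → LogGateCriterion` -/

/-- The gate transports EXACTLY under the time dilation `v(s,x) = c₀·u(c₀ s, x)`, `c₀ = ν⁻¹` (space untouched):
`E_{c,1}(r) = ν⁻¹ · E_{c,ν}(r)`. -/
theorem logInflowEnvelope_dilate (c ν r : ℝ) (hν : 0 < ν) :
    logInflowEnvelope c 1 r = ν⁻¹ * logInflowEnvelope c ν r := by
  unfold logInflowEnvelope
  field_simp

/-- **O4 PROVED.** TIME DILATION `v(s,x) = c₀·u(c₀ s, x)`, `c₀ = ν⁻¹` carries the unit-viscosity criterion to every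
`ν > 0` (verbatim kappa-inflow `scaling_holds`, ns-idea-4 g9, with the envelope line replaced): inputs BY NAME
`IsClassicalNSSolutionOn.timeDilate_Ico`, `hasSmoothExtensionPast_timeDilate_iff`, `IsLerayHopfOn.viscosityRescale`,
`IsClassicalNSSolutionOn.contDiff_velocity` + `iteratedFDeriv_const_smul_apply`, `rotZL`, `real_inner_smul_left`. -/
theorem logScaling_holds (hR1 : LogGateCriterionNuOne) : LogGateCriterion := by
  intro c₁ δ₀ ν T hc₁ hδ hδ' hν hT u p hcl hLH hdec hbd hax hgate
  set c : ℝ := ν⁻¹ with hc_def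
  have hc : 0 < c := inv_pos.2 hν
  have hcν : c * ν = 1 := inv_mul_cancel₀ hν.ne'
  have hTc : 0 < T / c := div_pos hT hc
  have hmem : ∀ s ∈ Ico 0 (T / c), c * s ∈ Ico 0 T := by
    intro s hs
    refine ⟨mul_nonneg hc.le hs.1, ?_⟩
    have := (lt_div_iff₀ hc).1 hs.2
    linarith [mul_comm s c]
  -- (1) classical on [0, T/c) at viscosity 1
  have hcl' : IsClassicalNSSolutionOn (Ico 0 (T / c)) 1 0 (timeRescale c c u) (timeRescale c (c ^ 2) p) := by
    have := hcl.timeDilate_Ico hc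
    rwa [hcν, timeRescale_zero_force] at this
  -- (2) Leray–Hopf
  have h0 : timeRescale c c u 0 = c • u 0 := by
    funext x; simp
  have hLH' : IsLerayHopfOn (T / c) 1 0 (timeRescale c c u 0) (timeRescale c c u) := by
    have := hLH.viscosityRescale hc
    rwa [hcν, timeRescale_zero_force, ← h0] at this
  -- (3) rapid decay of the datum
  have hdec' : HasRapidSpatialDecay (timeRescale c c u 0) := by
    rw [h0]
    have hsm := hcl.contDiff_velocity (t := 0) ⟨le_rfl, hT⟩
    intro n K
    obtain ⟨C, hC⟩ := hdec n K
    refine ⟨|c| * C, fun x => ?_⟩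
    have hn : ContDiffAt ℝ n (u 0) x := (hsm.of_le (by exact_mod_cast le_top)).contDiffAt
    rw [iteratedFDeriv_const_smul_apply hn, norm_smul, Real.norm_eq_abs]
    calc (1 + ‖x‖) ^ K * (|c| * ‖iteratedFDeriv ℝ n (u 0) x‖)
        = |c| * ((1 + ‖x‖) ^ K * ‖iteratedFDeriv ℝ n (u 0) x‖) := by ring
      _ ≤ |c| * C := mul_le_mul_of_nonneg_left (hC x) (abs_nonneg c)
  -- (4) bounded on closed sub-strips
  have hbd' : ∀ T' < T / c, ∃ B : ℝ, ∀ s ∈ Icc 0 T', ∀ x, ‖timeRescale c c u s x‖ ≤ B := by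
    intro T' hT'
    have hcT' : c * T' < T := by
      have := (lt_div_iff₀ hc).1 hT'
      linarith [mul_comm T' c]
    obtain ⟨B, hB⟩ := hbd (c * T') hcT'
    refine ⟨c * B, fun s hs x => ?_⟩
    have hcs : c * s ∈ Icc 0 (c * T') :=
      ⟨mul_nonneg hc.le hs.1, mul_le_mul_of_nonneg_left hs.2 hc.le⟩
    rw [timeRescale_apply, norm_smul, Real.norm_eq_abs, abs_of_pos hc]
    exact mul_le_mul_of_nonneg_left (hB _ hcs x) hc.le
  -- (5) axisymmetric slices
  have hax' : ∀ s ∈ Ico 0 (T / c), IsAxisymmetric (timeRescale c c u s) := by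
    intro s hs θ x
    rw [timeRescale_apply, timeRescale_apply, hax _ (hmem s hs) θ x,
      show rotZ θ (c • u (c * s) x) = rotZL θ (c • u (c * s) x) from rfl, map_smul, rotZL_apply]
  -- (6) the gate transports exactly
  have hgate' : HasLogGate c₁ δ₀ 1 (T / c) (timeRescale c c u) := by
    intro s hs x hx hxδ
    have h1 := hgate (c * s) (hmem s hs) x hx hxδ
    have hrad : radialVelocity (timeRescale c c u s) x = c * radialVelocity (u (c * s)) x := by
      simp only [radialVelocity, timeRescale_apply, real_inner_smul_left]
    rw [hrad, logInflowEnvelope_dilate c₁ ν (cylRadius x) hν, ← hc_def, ← mul_neg]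
    exact mul_le_mul_of_nonneg_left h1 hc.le
  -- apply the unit-viscosity criterion and dilate back
  have hext := hR1 c₁ δ₀ (T / c) hc₁ hδ hδ' hTc (timeRescale c c u) (timeRescale c (c ^ 2) p)
    hcl' hLH' hdec' hbd' hax' hgate'
  have key := hasSmoothExtensionPast_timeDilate_iff (f := (0 : ℝ → E3 → E3)) (u := u) (T := T) (ν := ν) hc
  rw [hcν, timeRescale_zero_force] at key
  exact key.1 hext

/-! ## §6 The kernel-checked compositions (v1.1: NO sorry in this file) -/


end Summit.NavierStokesRegularity.NavierStokesRegularity.Theorems.ScenarioCensus.LogGate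

end
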